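import Literature.IUT.LogThetaLattice.VerticallyCoricLGPArch
import Literature.IUT.LogThetaLattice.TensorPackets
import Literature.IUT.LogVolume.ArchimedeanPacketLogVolume
import HarnessLib

/-!
# [IUTchIII] Proposition 3.5 (ii) (b) "(Archimedean Primes)" at the level of the archimedean TENSOR PACKET
# `M_I = ⊗_{i ∈ S^±_{j+1}} ⊕_{v | v_ℚ} ℂ_v` with the container `π^{j+1}·B_I` of [IUTchIV] Thm. 1.10, Step (vii)
# — proof-only companion of `VerticallyCoricLGP.lean` (abc-iut cell, layer L6, slice [IUTchIII] §3; node
# IUTchIII:Prop3.5(ii); packet-level sequel of abc-iut-c312-12's one-factor `VerticallyCoricLGPArch.lean`)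

S. Mochizuki, *Inter-universal Teichmüller theory III*, kurims manuscript (May 2020), §3, Proposition 3.5
(ii) (b), p. 105, read on the page [claim: Mochizuki2012, status: disputed]: "For `v_ℚ ∈ 𝕍^arc_ℚ`, the
closed unit ball `𝓘(^{S^±_{j+1}}𝓕(^{n,∘}𝔇_≻)_{v_ℚ})` … contains the image, via the tensor product, over
`|t| ∈ {0, …, j}`, of the [relevant] Kummer isomorphisms of (i), of both (1) the groups of units
`(Ψ_cns(^{n,m}𝔉_≻)_{|t|})^×_v`, for `𝕍 ∋ v | v_ℚ`, and (2) the closed balls of radius `π` inside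
`(Ψ_cns(^{n,m}𝔉_≻)_{|t|})^{gp}_v` …, for `𝕍 ∋ v | v_ℚ`. Here, we recall … that, if we regard each log-link as
a correspondence that only concerns the units that appear in its domain [cf. Remark 1.1.1], then a closed
ball as in (2) contains, for each `m' ≥ 1`, a subset that surjects, via the `m'`-th iterate of the log-link
…, onto the subset of the group of units `(Ψ_cns(^{n,m−m'}𝔉_≻)_{|t|})^×_v` on which this iterate is defined."
*Inter-universal Teichmüller theory IV*, RIMS manuscript (Apr. 2020), proof of Thm. 1.10, Step (vii),
pp. 29–30: "by taking `I` to be `S^±_{j+1}` … `π^{j+1}·B_I` serves as a container for the “union of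
possible images of a Θ-pilot object” … [it] contains the elements of `M_I` obtained by forming the tensor
product of elements of the log-shells".

abc-iut-L6-t4 types the clause as the predicate `Prop35ii_b I G U B κ lam Dom` (`VerticallyCoricLGP.lean`);
abc-iut-c312-12 DISCHARGES it at ONE FACTOR over the genuine complex exponential (`prop35ii_b_arcExp`,
`VerticallyCoricLGPArch.lean`: carriers `ℂ`, `𝒪^× = arcUnits`, `ℐ = arcLogShell = {|a| ≤ π}`, the `m'`-fold
covering map `exp^[m']`, the principal-branch domains `arcIterDomain m'`, CHOSEN bounded witness subsets).
This file DISCHARGES the clause AT THE PACKET — "the tensor product, over `|t| ∈ {0, …, j}`", all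
`v | v_ℚ` at once — over the REAL archimedean packet of the campaign-S files
(`Literature.IUT.LogVolume.ArchimedeanTensorCopies` / `ArchimedeanPacketLogVolume`, [IUTchIV] Prop. 1.5
(iii)/(iv), Thm. 1.10 Step (vii)): `X := M_I = ⊗_{i∈I} ⊕_{v∈V} ℂ_v` (`Prop15iii.MI I V`, Mathlib's
`PiTensorProduct` over `ℝ`; `I` = the capsule index set `S^±_{j+1}`, `V` = the archimedean places over `v_ℚ`);
the "closed unit ball" `𝓘(^{S^±_{j+1}}𝓕(^{n,∘}𝔇_≻)_{v_ℚ})` READ AS the Step (vii) container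
`π^{|I|}·B_I` (`Real.pi ^ Fintype.card I • Prop15iii.ball Φ` for a direct sum decomposition `Φ` of `M_I`
into copies of `ℂ`; honest note: [IUTchIII] speaks of the unit ball of the tensor-product Hermitian metric,
[IUTchIV] Step (vii) replaces it by this container via Prop. 1.5 (iii), (iv) — the tree's archimedean
volume computations are stated for the container, so this is the reading that feeds them); carriers
`G m := ∏_{i,v} ℂ` (one universal covering `Ψ^∼` per factor and place, Def. 1.1 (ii)); unit groups
`U m := ∏ 𝒪^×_{ℂ_v}`; radius-`π` balls `B m := ∏ {|a| ≤ π}`; Kummer maps `κ m (g) := ⊗_i (g_{i,v})_v` (the pure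
tensor, read in the coric copy); `lam m m' (g) := (exp^[m'] g_{i,v})_{i,v}` (the `m'`-fold covering map in
every coordinate); `Dom m m' := ∏ arcIterDomain m'`.

* `exists_arcWitness` — the one-factor witness of abc-iut-c312-12 repackaged: for each `m' ≥ 1` a subset
  `T ⊆ {|a| ≤ π}` with `exp^[m'](T) = 𝒪^× ∩ arcIterDomain m'`;
* **`prop35ii_b_archPacket` — `Prop35ii_b` HOLDS at the archimedean packet**: (1) the pure tensors of
  units and (2) the pure tensors of elements of the radius-`π` balls lie in `π^{|I|}·B_I` (campaign-S
  `tprod_mem_pi_pow_smul_ball`, the `≤`-form of [IUTchIV] Prop. 1.5 (iv)); and for each `m' ≥ 1` the product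
  `∏_{i,v} T` of the chosen one-factor witnesses is a subset of the product of radius-`π` balls that the
  coordinatewise `m'`-fold covering map carries onto exactly `∏ (𝒪^× ∩ arcIterDomain m')` = the portion of
  the product of unit groups on which the iterate is defined.

No new definitions; classical bookkeeping over landed definitions (one-variable complex analysis is all
in the one-factor file). Nothing here bears on the disputed [IUTchIII] Cor. 3.12 or takes a side; typed ≠
discharged elsewhere; instantiated ≠ endorsed.
-/

noncomputable section

namespace Literature.IUT.LogThetaLattice

open Set
open Literature.IUT.LogVolume Literature.IUT.LogVolume.Prop15iii PiTensorProduct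
open scoped Pointwise

/-! ### The one-factor witness sets of `VerticallyCoricLGPArch.lean`, repackaged -/

/-- **IUTchIII:Prop3.5(ii)(b)** (kurims p. 105), one factor: for each `m' ≥ 1` there is a subset `T` of the
radius-`π` ball `{|a| ≤ π}` (`arcLogShell`) which the `m'`-fold covering map `exp^[m']` carries onto EXACTLY
the portion `𝒪^× ∩ arcIterDomain m'` of the units on which the `m'`-th iterate of the log-link is defined —
extracted from abc-iut-c312-12's `prop35ii_b_arcExp` (witnesses: the segment `i·(−π, π]`, `{±(π/2)i}`, `∅`).
PROVED. [claim: Mochizuki2012, status: disputed] -/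
theorem exists_arcWitness {m' : ℕ} (hm : 1 ≤ m') :
    ∃ T ⊆ arcLogShell, Complex.exp^[m'] '' T = arcUnits ∩ arcIterDomain m' := by
  obtain ⟨S, hS, heq⟩ := prop35ii_b_arcExp.2.2 0 m' hm
  refine ⟨S, hS, ?_⟩
  have hdom : {y : ℂ | ∃ x ∈ arcIterDomain m', y = x} = arcIterDomain m' := by
    ext y
    exact ⟨fun ⟨x, hx, hxy⟩ => hxy ▸ hx, fun hy => ⟨y, hy, rfl⟩⟩
  have himg : {y : ℂ | ∃ x ∈ S, some (Complex.exp^[m'] x) = some y} = Complex.exp^[m'] '' S := by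
    ext y
    simp only [Option.some.injEq, mem_setOf_eq, mem_image]
  rw [← himg, heq, hdom]

/-! ### Proposition 3.5 (ii) (b) at the archimedean tensor packet -/

variable {I V J : Type} [Fintype I] [DecidableEq I] [Fintype V] [DecidableEq V]

/-- **IUTchIII:Prop3.5(ii)(b)** (kurims p. 105) **"(Archimedean Primes)" — `Prop35ii_b` HOLDS AT THE
ARCHIMEDEAN TENSOR PACKET** `M_I = ⊗_{i∈I} ⊕_{v∈V} ℂ_v` (campaign-S `Prop15iii.MI I V`; `I = S^±_{j+1}`, `V` =
the places over `v_ℚ ∈ 𝕍^arc_ℚ`) with "the closed unit ball `𝓘(^{S^±_{j+1}}𝓕(^{n,∘}𝔇_≻)_{v_ℚ})`" read as the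
[IUTchIV] Thm. 1.10 Step (vii) container `π^{|I|}·B_I` of a direct sum decomposition `Φ` (`Prop15iii.ball`):
for the carriers `∏_{i,v} ℂ` (universal coverings), unit groups `∏ 𝒪^×`, radius-`π` balls `∏ {|a| ≤ π}`,
Kummer maps `g ↦ ⊗_i (g_{i,v})_v`, the coordinatewise `m'`-fold covering maps `exp^[m']` as the iterates of
the log-link and `∏ arcIterDomain m'` as their domains on the units — (1) `⊗` of units `∈ π^{|I|}·B_I`;
(2) `⊗` of radius-`π`-ball elements `∈ π^{|I|}·B_I` ("contains the elements of `M_I` obtained by forming the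
tensor product of elements of the log-shells", IV p. 30; campaign-S `tprod_mem_pi_pow_smul_ball`); and for
each `m' ≥ 1` the product of abc-iut-c312-12's chosen one-factor witnesses is a subset of the product of
balls that the iterate carries onto exactly the portion of `∏ 𝒪^×` on which it is defined. PROVED.
[claim: Mochizuki2012, status: disputed] -/
theorem prop35ii_b_archPacket (Φ : Decomposition I V J) :
    Prop35ii_b (X := MI I V) (Real.pi ^ Fintype.card I • ball Φ)
      (fun _ : ℤ => I → M V)
      (fun _ => {g | ∀ i v, g i v ∈ arcUnits}) (fun _ => {g | ∀ i v, g i v ∈ arcLogShell})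
      (fun _ g => tprod ℝ g)
      (fun _ (m' : ℕ) g => some (fun i v => Complex.exp^[m'] (g i v)))
      (fun _ (m' : ℕ) => {g | ∀ i v, g i v ∈ arcIterDomain m'}) := by
  refine ⟨fun m => ?_, fun m => ?_, fun m m' hm => ?_⟩
  · rintro _ ⟨g, hg, rfl⟩
    exact tprod_mem_pi_pow_smul_ball Φ g fun i v => arcUnits_subset_arcLogShell (hg i v)
  · rintro _ ⟨g, hg, rfl⟩
    exact tprod_mem_pi_pow_smul_ball Φ g fun i v => hg i v
  · obtain ⟨T, hT, hTeq⟩ := exists_arcWitness hm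
    refine ⟨{g | ∀ i v, g i v ∈ T}, fun g hg i v => hT (hg i v), ?_⟩
    ext y
    simp only [Option.some.injEq, mem_setOf_eq, mem_inter_iff]
    constructor
    · rintro ⟨x, hx, rfl⟩
      have hmem : ∀ i v, Complex.exp^[m'] (x i v) ∈ arcUnits ∩ arcIterDomain m' := fun i v => by
        rw [← hTeq]
        exact ⟨x i v, hx i v, rfl⟩
      exact ⟨fun i v => (hmem i v).1, ⟨fun i v => Complex.exp^[m'] (x i v), fun i v => (hmem i v).2, rfl⟩⟩
    · rintro ⟨hyU, z, hz, hyz⟩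
      rw [hyz] at hyU ⊢
      have hpre : ∀ i v, ∃ x ∈ T, Complex.exp^[m'] x = z i v := fun i v => by
        have h : z i v ∈ Complex.exp^[m'] '' T := by
          rw [hTeq]
          exact ⟨hyU i v, hz i v⟩
        exact h
      choose x hxT hxz using hpre
      exact ⟨x, hxT, funext fun i => funext fun v => hxz i v⟩

end Literature.IUT.LogThetaLattice

end

/-! ### Appended (v2): transport of `Prop35ii_b` / `Prop35ii_a` along a map of ambient modules, and the
### archimedean packet clause on ANY packet mapping to `M_I` — in particular on abc-iut-L6-t4's `ℚ`-tensor
### packet `MPacketN ℚ` (the shape of the Cor. 3.12 crew's `LogShells.Packet`, abc-iut-c312-1 `packet_eq`) -/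

namespace Literature.IUT.LogThetaLattice

open Set
open Literature.IUT.LogVolume Literature.IUT.LogVolume.Prop15iii PiTensorProduct
open scoped Pointwise

universe u u' w

/-- TRANSPORT (bookkeeping): `Prop35ii_b` for an ambient module `X` with shell `I` and Kummer maps `κ m` pulls
back along ANY map `β : Y → X` to the ambient `Y` with shell `β⁻¹(I)` and Kummer maps `κ' m` lifting the `κ m`
(`β ∘ κ' m = κ m`); the carriers, unit groups, balls, log-iterates and domains are untouched (the surjection
clause does not mention the ambient module). This is how the clause proved on the `ℝ`-tensor packet `M_I`
descends to any packet mapping to it (e.g. a `ℚ`-tensor packet, below). [claim: Mochizuki2012, status: disputed] -/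
theorem Prop35ii_b.preimage {X : Type u} {Y : Type u'} {I : Set X} {G : ℤ → Type w} {U B : ∀ m, Set (G m)}
    {κ : ∀ m, G m → X} {lam : ∀ m (m' : ℕ), G m → Option (G (m - m'))} {Dom : ∀ m (m' : ℕ), Set (G m)}
    (h : Prop35ii_b I G U B κ lam Dom) (β : Y → X) (κ' : ∀ m, G m → Y) (hκ : ∀ m x, β (κ' m x) = κ m x) :
    Prop35ii_b (β ⁻¹' I) G U B κ' lam Dom := by
  refine ⟨fun m => ?_, fun m => ?_, h.2.2⟩
  · rintro _ ⟨x, hx, rfl⟩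
    show β (κ' m x) ∈ I
    rw [hκ]
    exact h.1 m ⟨x, hx, rfl⟩
  · rintro _ ⟨x, hx, rfl⟩
    show β (κ' m x) ∈ I
    rw [hκ]
    exact h.2.1 m ⟨x, hx, rfl⟩

/-- TRANSPORT (bookkeeping), nonarchimedean sibling: `Prop35ii_a` pulls back along any map `β : Y → X` with
shell `β⁻¹(I)`, Kummer maps `κ'` lifting `κ` and log-iterate pre-composites `lam'` lifting `lam` (valuewise
through `β`). [claim: Mochizuki2012, status: disputed] -/
theorem Prop35ii_a.preimage {X : Type u} {Y : Type u'} {I : Set X} {U : ℤ → Type w} {κ : ∀ m, U m → X}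
    {lam : ∀ m (m' : ℕ), 1 ≤ m' → U m → Option X} (h : Prop35ii_a I U κ lam) (β : Y → X)
    (κ' : ∀ m, U m → Y) (lam' : ∀ m (m' : ℕ), 1 ≤ m' → U m → Option Y)
    (hκ : ∀ m u, β (κ' m u) = κ m u) (hlam : ∀ m m' hm u, (lam' m m' hm u).map β = lam m m' hm u) :
    Prop35ii_a (β ⁻¹' I) U κ' lam' := by
  refine ⟨fun m u => ?_, fun m m' hm u y hy => ?_⟩
  · show β (κ' m u) ∈ I
    rw [hκ]
    exact h.1 m u
  · show β y ∈ I
    refine h.2 m m' hm u (β y) ?_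
    rw [← hlam m m' hm u, hy, Option.map_some]

variable {I V J : Type} [Fintype I] [DecidableEq I] [Fintype V] [DecidableEq V]

/-- **IUTchIII:Prop3.5(ii)(b)** (kurims p. 105) **at ANY packet `Y` mapping to the archimedean tensor packet
`M_I`**: if `β : Y → M_I` and the Kummer maps `κ' : ∏_{i,v} ℂ → Y` satisfy `β (κ' g) = ⊗_i g_i`, then
`Prop35ii_b` HOLDS on `Y` with "the closed unit ball" read as `β⁻¹(π^{|I|}·B_I)` and the data of
`prop35ii_b_archPacket` (units, radius-`π` balls, coordinatewise covering maps, `arcIterDomain`). PROVED.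
[claim: Mochizuki2012, status: disputed] -/
theorem prop35ii_b_archPacket_preimage (Φ : Decomposition I V J) {Y : Type u'} (β : Y → MI I V)
    (κ' : ℤ → (I → M V) → Y) (hκ : ∀ m g, β (κ' m g) = tprod ℝ g) :
    Prop35ii_b (X := Y) (β ⁻¹' (Real.pi ^ Fintype.card I • ball Φ))
      (fun _ : ℤ => I → M V)
      (fun _ => {g | ∀ i v, g i v ∈ arcUnits}) (fun _ => {g | ∀ i v, g i v ∈ arcLogShell})
      κ'
      (fun _ (m' : ℕ) g => some (fun i v => Complex.exp^[m'] (g i v)))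
      (fun _ (m' : ℕ) => {g | ∀ i v, g i v ∈ arcIterDomain m'}) :=
  (prop35ii_b_archPacket Φ).preimage β κ' hκ

/-- **IUTchIII:Prop3.5(ii)(b)** (kurims p. 105) **on the `ℚ`-TENSOR PACKET** `⊗_ℚ^{i∈I} ⊕_{v∈V} ℂ_v`
(abc-iut-L6-t4's `MPacketN ℚ (fun _ _ ↦ ℂ)` — the shape `MPacketN ℚ (capsuleCarriers)` of the Cor. 3.12 crew's
strictified packets, abc-iut-c312-1 `LogShells.packet_eq`, at complex carriers): along the canonical
base-change map `β := PiTensorProduct.lift ((tprod ℝ).restrictScalars ℚ) : ⊗_ℚ → ⊗_ℝ = M_I` (`β(⊗_ℚ g) = ⊗_ℝ g`),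
`Prop35ii_b` HOLDS with "the closed unit ball" := `β⁻¹(π^{|I|}·B_I)` (the [IUTchIV] Step (vii) container pulled
back), Kummer maps `g ↦ ⊗_ℚ g`, and the data of `prop35ii_b_archPacket`. PROVED.
[claim: Mochizuki2012, status: disputed] -/
theorem prop35ii_b_archPacketRat (Φ : Decomposition I V J) :
    Prop35ii_b (X := MPacketN ℚ (fun (_ : I) (_ : V) => ℂ))
      ((PiTensorProduct.lift ((PiTensorProduct.tprod ℝ (s := fun _ : I => M V)).restrictScalars ℚ)) ⁻¹'
        (Real.pi ^ Fintype.card I • ball Φ))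
      (fun _ : ℤ => I → M V)
      (fun _ => {g | ∀ i v, g i v ∈ arcUnits}) (fun _ => {g | ∀ i v, g i v ∈ arcLogShell})
      (fun _ g => tprod ℚ g)
      (fun _ (m' : ℕ) g => some (fun i v => Complex.exp^[m'] (g i v)))
      (fun _ (m' : ℕ) => {g | ∀ i v, g i v ∈ arcIterDomain m'}) :=
  prop35ii_b_archPacket_preimage Φ _ _ fun _ g => by
    rw [PiTensorProduct.lift.tprod]
    rfl

end Literature.IUT.LogThetaLattice
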